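import Mathlib

/-!
# Crux `NikulinSerreCarrier` · line `neron-severi-intertwiner` · stub `stub_nikulinAnchorFrame` (S1) —
# the COMPLETED NIKULIN SIMILITUDE `Ψ = g^* ⊕ (N_j ↦ r_j)`: pure linear algebra

Helper file (`--supports stmt-HodgeConjecture-14464`) for the anchor stub `stub_nikulinAnchorFrame` of the
skeleton `Cruxes/NikulinSerreCarrier/Lines/neron-severi-intertwiner.lean`. The anchor's similitude is
the COMPLETION of the degree-two quotient correspondence `g^* = β_*π^* : H²(Y′) → H²(X)` of a Nikulin
involution (van Geemen–Sarti 2007 §1.4–1.8, §2.5: `g^*` kills the nodal classes `N_1, …, N_8` of the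
resolved quotient `Y′ = \widetilde{X/ι}`, lands in the `ι^*`-invariants, and multiplies the cup form by
`2` on `N^⊥`) by the `A₁⁸` frame `r_1, …, r_8` of the anti-invariant lattice `E₈(−2) ⊂ NS(X)`
(route item `EEightTwoSimilitude`, proved): `Ψ := g^* ∘ pr_{N^⊥} + Σ_j ℓ_j(–) r_j`,
`ℓ_j(y) = −½ (y.N_j)`, so that `Ψ|_{N^⊥} = g^*`, `Ψ(N_j) = r_j`.

This file is the abstract bookkeeping, over any field `K`, for abstract data `(V, B)`, `(W, B_W)`,
`g : V →ₗ W`, `N : Fin 8 → V`, `r : Fin 8 → W`, written WITHOUT new definitions: the nodal coefficient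
functionals `ℓ_j` and the completed map `Ψ` enter every lemma through the two characterising
hypotheses `hℓ : ℓ_j(y) = −½ B(y, N_j)` and `hΨ : Ψ y = g (y − Σ_j ℓ_j(y) N_j) + Σ_j ℓ_j(y) r_j`, and
`exists_completedSimilitude` constructs the pair once.
* `map_nodal_of_formula` (`Ψ N_i = r_i`), `map_eq_of_perp_of_formula` (`Ψ = g` on `N^⊥`);
* `bilin_map_map_of_formula` — THE POINT: if `(N_i.N_j) = −2δ_ij`, `(r_i.r_j) = −4δ_ij`,
  `(g x.g y) = 2(x.y)` on `N^⊥` and `g(N^⊥) ⊥ r_j`, then `(Ψ x.Ψ y) = 2 (x.y)` for ALL `x, y`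
  (a `2`-similitude on the whole space), hence `Ψ` is injective when `B` is non-degenerate;
* `map_mem_of_formula` (submodules: the `(1,1)`-bookkeeping) and `map_preserves_of_formula` (an
  additive `ℚ`-stable predicate — a `ℚ`-structure — is carried to one on `W`: rationality);
* `exists_map_eq_of_mem_span_of_formula` (every combination of the `r_j` is `Ψ` of the same
  combination of the `N_j`: the "anti-invariant classes come from divisor classes" clause).
No geometry here; the K3 instantiation is a sibling file.
-/

-- the doubled component `HodgeConjecture.HodgeConjecture` is the summit/problem layout (D-0022), not a slip
set_option linter.dupNamespace false

namespace Summit.HodgeConjecture.HodgeConjecture.Theorems.NikulinSerreCarrier.NeronSeveriIntertwiner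

open scoped BigOperators

section General

variable {K : Type*} [Field K] {V W : Type*} [AddCommGroup V] [Module K V] [AddCommGroup W] [Module K W]
  {B : LinearMap.BilinForm K V} {BW : LinearMap.BilinForm K W} {N : Fin 8 → V} {g : V →ₗ[K] W}
  {r : Fin 8 → W} {ℓ : Fin 8 → V →ₗ[K] K} {Ψ : V →ₗ[K] W}

/-! ### Values on the nodal vectors and on their orthogonal complement -/

/-- On a vector orthogonal to all `N_j` every nodal coefficient `ℓ_j(y) = −½ B(y, N_j)` vanishes.
[folklore] -/
theorem nodalCoeff_eq_zero_of_perp (hℓ : ∀ j y, ℓ j y = -((2 : K)⁻¹ * B y (N j))) {y : V}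
    (hy : ∀ j, B y (N j) = 0) (j : Fin 8) : ℓ j y = 0 := by
  rw [hℓ, hy j, mul_zero, neg_zero]

/-- **`Ψ = g` on `N^⊥`** for the completed map `Ψ y = g (y − Σ ℓ_j(y) N_j) + Σ ℓ_j(y) r_j`.
[cite: VanGeemenSarti2007, §2.5] -/
theorem map_eq_of_perp_of_formula (hℓ : ∀ j y, ℓ j y = -((2 : K)⁻¹ * B y (N j)))
    (hΨ : ∀ y, Ψ y = g (y - ∑ j, ℓ j y • N j) + ∑ j, ℓ j y • r j) {y : V} (hy : ∀ j, B y (N j) = 0) :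
    Ψ y = g y := by
  rw [hΨ, Finset.sum_eq_zero fun j _ ↦ by rw [nodalCoeff_eq_zero_of_perp hℓ hy j, zero_smul],
    Finset.sum_eq_zero fun j _ ↦ by rw [nodalCoeff_eq_zero_of_perp hℓ hy j, zero_smul], sub_zero, add_zero]

/-- For nodal vectors with `(N_i.N_j) = −2δ_ij` (and `2 ≠ 0` in `K`): `ℓ_j(N_i) = δ_ij`. [folklore] -/
theorem nodalCoeff_nodal (hℓ : ∀ j y, ℓ j y = -((2 : K)⁻¹ * B y (N j)))
    (hN : ∀ i j, B (N i) (N j) = if i = j then -2 else 0) (h2 : (2 : K) ≠ 0) (i j : Fin 8) :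
    ℓ j (N i) = if i = j then 1 else 0 := by
  rw [hℓ, hN i j]
  split_ifs
  · rw [mul_neg, neg_neg, inv_mul_cancel₀ h2]
  · rw [mul_zero, neg_zero]

/-- The nodal projection `Σ_j ℓ_j(–) N_j` fixes the nodal vectors. [folklore] -/
theorem sum_nodalCoeff_smul_nodal (hℓ : ∀ j y, ℓ j y = -((2 : K)⁻¹ * B y (N j)))
    (hN : ∀ i j, B (N i) (N j) = if i = j then -2 else 0) (h2 : (2 : K) ≠ 0) (i : Fin 8) (v : Fin 8 → W) :
    ∑ j, ℓ j (N i) • v j = v i := by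
  simp only [nodalCoeff_nodal hℓ hN h2, ite_smul, one_smul, zero_smul]
  rw [Finset.sum_ite_eq, if_pos (Finset.mem_univ i)]

/-- **`Ψ N_i = r_i`.** [cite: VanGeemenSarti2007, §1.5 and §1.8] -/
theorem map_nodal_of_formula (hℓ : ∀ j y, ℓ j y = -((2 : K)⁻¹ * B y (N j)))
    (hΨ : ∀ y, Ψ y = g (y - ∑ j, ℓ j y • N j) + ∑ j, ℓ j y • r j)
    (hN : ∀ i j, B (N i) (N j) = if i = j then -2 else 0) (h2 : (2 : K) ≠ 0) (i : Fin 8) :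
    Ψ (N i) = r i := by
  rw [hΨ, sum_nodalCoeff_smul_nodal hℓ hN h2 i N, sum_nodalCoeff_smul_nodal hℓ hN h2 i r, sub_self,
    map_zero, zero_add]

/-- `Ψ (Σ c_j N_j) = Σ c_j r_j`. [folklore] -/
theorem map_sum_smul_nodal_of_formula (hℓ : ∀ j y, ℓ j y = -((2 : K)⁻¹ * B y (N j)))
    (hΨ : ∀ y, Ψ y = g (y - ∑ j, ℓ j y • N j) + ∑ j, ℓ j y • r j)
    (hN : ∀ i j, B (N i) (N j) = if i = j then -2 else 0) (h2 : (2 : K) ≠ 0) (c : Fin 8 → K) :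
    Ψ (∑ j, c j • N j) = ∑ j, c j • r j := by
  rw [map_sum]
  refine Finset.sum_congr rfl fun j _ ↦ ?_
  rw [map_smul, map_nodal_of_formula hℓ hΨ hN h2 j]

/-- **Every combination of the `r_j` is `Ψ` of the same combination of the `N_j`** — in the anchor:
every `ι^*`-anti-invariant class (`E₈(−2) ⊗ ℂ = span r_j`) is `Ψ` of a class in the span of the nodal
(divisor) classes. [cite: VanGeemenSarti2007, §1.3 and §1.5] -/
theorem exists_map_eq_of_mem_span_of_formula (hℓ : ∀ j y, ℓ j y = -((2 : K)⁻¹ * B y (N j)))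
    (hΨ : ∀ y, Ψ y = g (y - ∑ j, ℓ j y • N j) + ∑ j, ℓ j y • r j)
    (hN : ∀ i j, B (N i) (N j) = if i = j then -2 else 0) (h2 : (2 : K) ≠ 0) {w : W}
    (hw : w ∈ Submodule.span K (Set.range r)) :
    ∃ v ∈ Submodule.span K (Set.range N), Ψ v = w := by
  obtain ⟨c, rfl⟩ := (Submodule.mem_span_range_iff_exists_fun K).1 hw
  exact ⟨∑ j, c j • N j, Submodule.sum_mem _ fun j _ ↦
    Submodule.smul_mem _ _ (Submodule.subset_span ⟨j, rfl⟩), map_sum_smul_nodal_of_formula hℓ hΨ hN h2 c⟩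

/-- The vector `y − Σ_j ℓ_j(y) N_j` is orthogonal to every `N_j` (for `(N_i.N_j) = −2δ_ij`). [folklore] -/
theorem bilin_sub_proj_nodal (hℓ : ∀ j y, ℓ j y = -((2 : K)⁻¹ * B y (N j)))
    (hN : ∀ i j, B (N i) (N j) = if i = j then -2 else 0) (h2 : (2 : K) ≠ 0) (y : V) (j : Fin 8) :
    B (y - ∑ i, ℓ i y • N i) (N j) = 0 := by
  have h22 : (2 : K)⁻¹ * 2 = 1 := inv_mul_cancel₀ h2
  rw [map_sub, LinearMap.sub_apply, map_sum, LinearMap.sum_apply]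
  simp only [map_smul, LinearMap.smul_apply, hN, smul_eq_mul, mul_ite, mul_neg, mul_zero]
  rw [Finset.sum_ite_eq', if_pos (Finset.mem_univ j), hℓ, neg_mul, neg_neg, mul_right_comm, h22,
    one_mul, sub_self]

/-! ### The `2`-similitude property -/

/-- **The completed map is a `2`-similitude on the whole space.** If `(N_i.N_j) = −2δ_ij`, `B(N_j, –)`
is `B(–, N_j)`, `(r_i.r_j) = −4δ_ij`, `g` multiplies the form by `2` on `N^⊥`, and `g(N^⊥)` is
orthogonal to the `r_j` (in the anchor: `g^*` lands in the `ι^*`-invariants, the `r_j` are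
anti-invariant), then `(Ψ x.Ψ y) = 2 (x.y)` for all `x, y`:
`(Ψx.Ψy) = (g x'.g y') − 4 Σ ℓ_i(x)ℓ_i(y) = 2(x'.y') + 2·(−2) Σ ℓ_i(x)ℓ_i(y) = 2(x.y)` with
`x' = x − Σ ℓ_j(x) N_j`. [cite: VanGeemenSarti2007, §1.8 and §2.5] -/
theorem bilin_map_map_of_formula (hℓ : ∀ j y, ℓ j y = -((2 : K)⁻¹ * B y (N j)))
    (hΨ : ∀ y, Ψ y = g (y - ∑ j, ℓ j y • N j) + ∑ j, ℓ j y • r j)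
    (hN : ∀ i j, B (N i) (N j) = if i = j then -2 else 0)
    (h2 : (2 : K) ≠ 0) (hNsymm : ∀ y j, B (N j) y = B y (N j))
    (hr : ∀ i j, BW (r i) (r j) = if i = j then -4 else 0)
    (hg : ∀ x y, (∀ j, B x (N j) = 0) → (∀ j, B y (N j) = 0) → BW (g x) (g y) = 2 * B x y)
    (hgr : ∀ x j, (∀ k, B x (N k) = 0) → BW (g x) (r j) = 0)
    (hrg : ∀ x j, (∀ k, B x (N k) = 0) → BW (r j) (g x) = 0) (x y : V) :
    BW (Ψ x) (Ψ y) = 2 * B x y := by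
  set x' := x - ∑ j, ℓ j x • N j with hx'def
  set y' := y - ∑ j, ℓ j y • N j with hy'def
  have hx' : ∀ j, B x' (N j) = 0 := bilin_sub_proj_nodal hℓ hN h2 x
  have hy' : ∀ j, B y' (N j) = 0 := bilin_sub_proj_nodal hℓ hN h2 y
  have h1 : BW (g x') (∑ j, ℓ j y • r j) = 0 := by
    rw [map_sum]
    exact Finset.sum_eq_zero fun j _ ↦ by rw [map_smul, hgr _ j hx', smul_zero]
  have h2' : BW (∑ j, ℓ j x • r j) (g y') = 0 := by
    rw [map_sum, LinearMap.sum_apply]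
    exact Finset.sum_eq_zero fun j _ ↦ by rw [map_smul, LinearMap.smul_apply, hrg _ j hy', smul_zero]
  have h3 : BW (∑ i, ℓ i x • r i) (∑ j, ℓ j y • r j) = ∑ i, ℓ i x * ℓ i y * (-4) := by
    rw [map_sum BW, LinearMap.sum_apply]
    refine Finset.sum_congr rfl fun i _ ↦ ?_
    rw [map_smul, LinearMap.smul_apply, map_sum]
    simp only [map_smul, smul_eq_mul, hr, mul_ite, mul_neg, mul_zero]
    rw [Finset.sum_ite_eq, if_pos (Finset.mem_univ i)]
    ring
  -- the right-hand side: `x = x' + Σ ℓ_j(x) N_j`, `y = y' + Σ ℓ_j(y) N_j`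
  have h5 : B x' (∑ j, ℓ j y • N j) = 0 := by
    rw [map_sum]
    exact Finset.sum_eq_zero fun j _ ↦ by rw [map_smul, hx' j, smul_zero]
  have h6 : B (∑ j, ℓ j x • N j) y' = 0 := by
    rw [map_sum, LinearMap.sum_apply]
    exact Finset.sum_eq_zero fun j _ ↦ by
      rw [map_smul, LinearMap.smul_apply, hNsymm, hy' j, smul_zero]
  have h7 : B (∑ i, ℓ i x • N i) (∑ j, ℓ j y • N j) = ∑ i, ℓ i x * ℓ i y * (-2) := by
    rw [map_sum B, LinearMap.sum_apply]
    refine Finset.sum_congr rfl fun i _ ↦ ?_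
    rw [map_smul, LinearMap.smul_apply, map_sum]
    simp only [map_smul, smul_eq_mul, hN, mul_ite, mul_neg, mul_zero]
    rw [Finset.sum_ite_eq, if_pos (Finset.mem_univ i)]
    ring
  have h4 : B x y = B x' y' + ∑ i, ℓ i x * ℓ i y * (-2) := by
    have hxy : B x y = B (x' + ∑ j, ℓ j x • N j) (y' + ∑ j, ℓ j y • N j) := by
      rw [hx'def, hy'def, sub_add_cancel, sub_add_cancel]
    rw [hxy]
    simp only [map_add, LinearMap.add_apply]
    rw [h5, h6, h7]
    simp only [add_zero, zero_add]
  -- the left-hand side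
  rw [hΨ x, hΨ y, ← hx'def, ← hy'def]
  simp only [map_add, LinearMap.add_apply]
  rw [hg _ _ hx' hy', h1, h2', h3, h4]
  simp only [add_zero, zero_add, mul_add, Finset.mul_sum]
  congr 1
  exact Finset.sum_congr rfl fun i _ ↦ by ring

/-- **A `2`-similitude for a non-degenerate form is injective** (over a field with `2 ≠ 0`). [folklore] -/
theorem injective_of_bilin_eq_two_mul (Φ : V →ₗ[K] W) (h2 : (2 : K) ≠ 0)
    (hB : ∀ x, (∀ y, B x y = 0) → x = 0) (hΦ : ∀ x y, BW (Φ x) (Φ y) = 2 * B x y) :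
    Function.Injective Φ := by
  refine (injective_iff_map_eq_zero Φ).2 fun x hx ↦ hB x fun y ↦ ?_
  have h := hΦ x y
  rw [hx, map_zero, LinearMap.zero_apply] at h
  rcases mul_eq_zero.1 h.symm with h' | h'
  · exact absurd h' h2
  · exact h'

/-! ### Compatibility with submodules (Hodge types) -/

/-- **Submodule bookkeeping** (the `(1,1)`-type clause of the anchor): if `g` maps `S` into `T`,
the `N_j` lie in `S` and the `r_j` in `T`, then `Ψ` maps `S` into `T`. [folklore] -/
theorem map_mem_of_formula (hΨ : ∀ y, Ψ y = g (y - ∑ j, ℓ j y • N j) + ∑ j, ℓ j y • r j)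
    (S : Submodule K V) (T : Submodule K W) (hg : ∀ v ∈ S, g v ∈ T)
    (hN : ∀ j, N j ∈ S) (hr : ∀ j, r j ∈ T) {y : V} (hy : y ∈ S) : Ψ y ∈ T := by
  rw [hΨ]
  exact T.add_mem (hg _ (S.sub_mem hy (S.sum_mem fun j _ ↦ S.smul_mem _ (hN j))))
    (T.sum_mem fun j _ ↦ T.smul_mem _ (hr j))

end General

/-! ### Compatibility with a `ℚ`-structure (rationality), over `ℂ`; existence of the completion -/

section Complex

variable {V W : Type*} [AddCommGroup V] [Module ℂ V] [AddCommGroup W] [Module ℂ W]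
  {B : LinearMap.BilinForm ℂ V} {N : Fin 8 → V} {g : V →ₗ[ℂ] W} {r : Fin 8 → W}
  {ℓ : Fin 8 → V →ₗ[ℂ] ℂ} {Ψ : V →ₗ[ℂ] W}

/-- **Rationality bookkeeping** (over `ℂ`, for predicates `P`, `Q` stable under addition and rational
scaling — in the anchor: `IsRationalClass` on `H²(Y′(ℂ); ℂ)` and `H²(X(ℂ); ℂ)`): if `g` carries `P` to
`Q`, the `N_j` satisfy `P`, the `r_j` satisfy `Q`, and `B(y, N_j) ∈ ℚ` for `P`-vectors `y`, then `Ψ`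
carries `P` to `Q`. [folklore] -/
theorem map_preserves_of_formula (hℓ : ∀ j y, ℓ j y = -((2 : ℂ)⁻¹ * B y (N j)))
    (hΨ : ∀ y, Ψ y = g (y - ∑ j, ℓ j y • N j) + ∑ j, ℓ j y • r j) (P : V → Prop) (Q : W → Prop)
    (hPadd : ∀ a b, P a → P b → P (a + b)) (hPsmul : ∀ (q : ℚ) a, P a → P ((q : ℂ) • a))
    (hQ0 : Q 0) (hQadd : ∀ a b, Q a → Q b → Q (a + b)) (hQsmul : ∀ (q : ℚ) a, Q a → Q ((q : ℂ) • a))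
    (hg : ∀ v, P v → Q (g v)) (hN : ∀ j, P (N j)) (hr : ∀ j, Q (r j))
    (hB : ∀ y, P y → ∀ j, ∃ q : ℚ, B y (N j) = (q : ℂ)) {y : V} (hy : P y) : Q (Ψ y) := by
  have hq : ∀ j, ∃ q : ℚ, ℓ j y = (q : ℂ) := fun j ↦ by
    obtain ⟨q, hq⟩ := hB y hy j
    exact ⟨-(2⁻¹ * q), by rw [hℓ, hq]; push_cast; ring⟩
  choose q hq using hq
  rw [hΨ]
  refine hQadd _ _ (hg _ ?_) ?_
  · -- `y − Σ ℓ_j(y) N_j`, one summand at a time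
    have key : ∀ s : Finset (Fin 8), P (y - ∑ j ∈ s, ℓ j y • N j) := by
      intro s
      induction s using Finset.induction_on with
      | empty => simpa using hy
      | insert j s hj ih =>
        rw [Finset.sum_insert hj, ← sub_sub, sub_right_comm, sub_eq_add_neg _ (_ • N j), hq j,
          ← neg_smul, ← Rat.cast_neg]
        exact hPadd _ _ ih (hPsmul _ _ (hN j))
    exact key Finset.univ
  · have key : ∀ s : Finset (Fin 8), Q (∑ j ∈ s, ℓ j y • r j) := by
      intro s
      induction s using Finset.induction_on with
      | empty => simpa using hQ0
      | insert j s hj ih =>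
        rw [Finset.sum_insert hj, hq j]
        exact hQadd _ _ (hQsmul _ _ (hr j)) ih
    exact key Finset.univ

variable (B N g r) in
/-- **Existence of the completion.** The nodal coefficient functionals `ℓ_j = −½ B(–, N_j)` and the
completed map `Ψ = g ∘ (1 − Σ_j ℓ_j ⊗ N_j) + Σ_j ℓ_j ⊗ r_j` exist as `ℂ`-linear maps satisfying their
defining formulas (so that all lemmas of this file apply to them). [cite: VanGeemenSarti2007, §1.8 and §2.5] -/
theorem exists_completedSimilitude :
    ∃ (ℓ : Fin 8 → V →ₗ[ℂ] ℂ) (Ψ : V →ₗ[ℂ] W), (∀ j y, ℓ j y = -((2 : ℂ)⁻¹ * B y (N j))) ∧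
      ∀ y, Ψ y = g (y - ∑ j, ℓ j y • N j) + ∑ j, ℓ j y • r j := by
  refine ⟨fun j ↦ -((2 : ℂ)⁻¹ • B.flip (N j)),
    g ∘ₗ (LinearMap.id - ∑ j, (-((2 : ℂ)⁻¹ • B.flip (N j))).smulRight (N j)) +
      ∑ j, (-((2 : ℂ)⁻¹ • B.flip (N j))).smulRight (r j), fun j y ↦ by simp, fun y ↦ ?_⟩
  simp [LinearMap.sum_apply]

end Complex

/-- **Registered stub `stub_anchorCompletedSimilitudeLinearAlgebra`** (crux item stmt-HodgeConjecture-14464,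
line `neron-severi-intertwiner`, sub-goal of `stub_nikulinAnchorFrame`): THE COMPLETED SIMILITUDE FROM `g^*` AND
AN `A₁⁸` FRAME — given abstract data `(V, B)`, `(W, B_W)`, `g`, `N_j`, `r_j` over `ℂ` with `(N_i.N_j) = −2δ_ij`,
`(r_i.r_j) = −4δ_ij`, `g` doubling the form on `N^⊥` and `g(N^⊥) ⊥ r_j`, there is a linear `Ψ` with
`Ψ N_j = r_j`, `Ψ = g` on `N^⊥`, `(Ψx.Ψy) = 2(x.y)` everywhere, injective when `B` is non-degenerate, and
hitting every combination of the `r_j` from the span of the `N_j` (registered one-line signature).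
[cite: VanGeemenSarti2007, §1.8 and §2.5] -/
theorem stub_anchorCompletedSimilitudeLinearAlgebra : ∀ {V W : Type} [AddCommGroup V] [Module ℂ V] [AddCommGroup W] [Module ℂ W] (B : LinearMap.BilinForm ℂ V) (BW : LinearMap.BilinForm ℂ W) (N : Fin 8 → V) (g : V →ₗ[ℂ] W) (r : Fin 8 → W), (∀ i j, B (N i) (N j) = if i = j then -2 else 0) → (∀ y j, B (N j) y = B y (N j)) → (∀ i j, BW (r i) (r j) = if i = j then -4 else 0) → (∀ x y, (∀ j, B x (N j) = 0) → (∀ j, B y (N j) = 0) → BW (g x) (g y) = 2 * B x y) → (∀ x j, (∀ k, B x (N k) = 0) → BW (g x) (r j) = 0 ∧ BW (r j) (g x) = 0) → ∃ Ψ : V →ₗ[ℂ] W, (∀ i, Ψ (N i) = r i) ∧ (∀ y, (∀ j, B y (N j) = 0) → Ψ y = g y) ∧ (∀ x y, BW (Ψ x) (Ψ y) = 2 * B x y) ∧ ((∀ x, (∀ y, B x y = 0) → x = 0) → Function.Injective Ψ) ∧ (∀ w ∈ Submodule.span ℂ (Set.range r), ∃ v ∈ Submodule.span ℂ (Set.range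 N), Ψ v = w) := by
  intro V W _ _ _ _ B BW N g r hN hNsymm hr hg hgr
  obtain ⟨ℓ, Ψ, hℓ, hΨ⟩ := exists_completedSimilitude B N g r
  have hsim := bilin_map_map_of_formula (BW := BW) hℓ hΨ hN two_ne_zero hNsymm hr hg
    (fun x j h ↦ (hgr x j h).1) (fun x j h ↦ (hgr x j h).2)
  exact ⟨Ψ, map_nodal_of_formula hℓ hΨ hN two_ne_zero, fun y hy ↦ map_eq_of_perp_of_formula hℓ hΨ hy, hsim,
    fun hB ↦ injective_of_bilin_eq_two_mul Ψ two_ne_zero hB hsim,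
    fun w hw ↦ exists_map_eq_of_mem_span_of_formula hℓ hΨ hN two_ne_zero hw⟩

end Summit.HodgeConjecture.HodgeConjecture.Theorems.NikulinSerreCarrier.NeronSeveriIntertwiner
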